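import Summits.NavierStokesRegularity.FunctionalMining.NoGo.StrainMomentLtTwoRadial
import HarnessLib

/-!
# FunctionalMining / NoGo — K11b (2/4): mean control `‖∫W‖ ≤ 4‖W − ∫W‖₂` when `∫‖W‖^γW = 0`, the
# regularised gradient bound at ANY real exponent, and the pairing `ψ` / secant-below-tangent for `Z_q`
# along a line for EVERY real `q > 1`

HONEST FRAMING. Search for candidate a priori estimates; no regularity claim. Nothing about
Navier–Stokes is proved or asserted in this file: inequalities for smooth vector fields on the
flat torus along the HEAT line `v + tΔv` (no transport term, no pressure) and lemmas of real
analysis. Cell `pub-nsfunc`, no-go seat (gen 39). K11 = FOUR files, imported in this order: K11a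
`NoGo/StrainMomentLtTwoRadial` → K11b `NoGo/StrainMomentLtTwoLine` → K11c `NoGo/StrainMomentLtTwoReg`
→ K11d `NoGo/StrainMomentHeatCoerciveLtTwo` (the row); K12 = `NoGo/TopBotEigHeatCoerciveLtTwo`.

THE TARGET (K11d). The tree proves the heat row of the strain moment `Z_q = torusStrainMoment q =
∫|S|^q` — `TopEig.HeatCoercive Z_q c`: `c·Z_q(v) ≤ heatDissipation Z_q v = −(d/dt)⁺Z_q(v+tΔv)|₀` on
smooth divergence-free `v` — for real `q > 2` (`TopEigStrainHeatLine`, through the weighted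
dissipation `D_Z = ∫|S|^{q−2}|∇S|²` and `npConst q`) and at `q = 2` (K7/K8). BELOW `q = 2` the weight
`|S|^{q−2}` is singular on `{S = 0}` and no `D_Z` is available; K11 proves the row for EVERY REAL
`1 < q < 2` without ever forming a weighted dissipation at `ε = 0`:
`TopEig.strainMoment_heatCoercive_of_lt_two (hq1 : 1 < q) (hq2 : q < 2) : HeatCoercive Z_q (c_Z q)`,
`c_Z q = TopEig.zqRateLtTwo q = 2π²q(q−1)/(51(2−q/2)²)` (not sharp), in FIELD FORM (every smooth `v`).
K12 re-runs K9's mixture principle with this row: `TopBotEigSplitting q c → 0 < c →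
TopBotEigHeatCoercivePos q` for `1 < q < 2` (door D-K6 (c) below `q = 2` REDUCED to the splitting, which
is NOT proved below `q = 2`).

WHAT IS PROVED HERE [ours], on the flat torus `T^d` (§4) and on `T³` (§5):
* §4 **`TopEig.norm_integral_le_of_rpow_smul_mean_zero`**: a continuous `W : T^d → F` with
  `∫‖W‖^γ W = 0`, `0 ≤ γ ≤ 1`, has `‖∫W‖ ≤ 4(∫‖W − ∫W‖²)^{1/2}` (the negative-exponent companion of the
  tree's `CodomainNP.norm_integral_rpow_smul_le`, via K11a §3 and Jensen
  `NonlinearPoincare.integral_rpow_le_rpow_integral`); **`TopEig.norm_partialDeriv_regA_le_abs`** /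
  **`TopEig.dirichlet_regA_le_abs`**: `‖∂ₖ((‖u‖²+ε)^{a/2}u)‖ ≤ (1+|a|)(‖u‖²+ε)^{a/2}‖∂ₖu‖` and the
  Dirichlet form with `(1+|a|)²`, ANY real `a`, `ε > 0` (the tree's `CodomainNP.norm_partialDeriv_regA_le`
  needs `0 ≤ a`).
* §5 **`TopEig.continuous_strainLinePairing_of_one_lt (hq : 1 < q)`** and
  **`TopEig.strainMoment_line_sub_le_of_one_lt (hq : 1 < q)`**: `τ ↦ ψ(τ)` is continuous and
  `Z_q(v+τw) − Z_q(v) ≤ τ·ψ(τ)` (smooth `v w` on `T³`) — the tree's `continuous_strainLinePairing` /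
  `strainMoment_line_sub_le` WITHOUT their hypothesis `2 < q`.

WHAT IS NOT PROVED HERE. The regularised sign and Poincaré steps (K11c) and the row (K11d).

PROVENANCE / STATUS. Typed and farm-checked by the no-go seat (gen 39): K11a stand-alone, the others as
concatenations with the union of their tree imports (evidence `pub-nsfunc-nogo/sieveld/kth/`: check
JSONs, a negative control, the by-value file `zqRateLtTwo (3/2) = 8π²/425`). STATUS: STAGED
(`pub-nsfunc-nogo/NoGo/<name>.STAGING.lean`); filing by a prove seat on the lead's word in the order
K11a → K11b → K11c → K11d → K12, after K8 `NoGo/TopBotEigHeatCoerciveTwoSharp` and K9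
`NoGo/TopBotEigHeatCoerciveSplit` (both in the tree); the planner seat cannot file under
`FunctionalMining/`. No constant is claimed sharp. Search for candidate a priori estimates; no
regularity claim. [ours; K1-Q6 = door D-K6, heat side, `1 < q < 2`]
FILING (prove seat g26, REQUEST #25b): declarations byte-identical to the no-go seat's staged `StrainMomentLtTwoLine.STAGING.lean` 32bf6f6a2a8a4d1a; this line is the only addition.
-/

noncomputable section

open MeasureTheory Finset Set Filter Topology
open scoped InnerProductSpace RealInnerProductSpace ContDiff Real

namespace Summit.NavierStokesRegularity.FunctionalMining

open Literature.Analysis.FunctionSpaces Literature.Analysis.FunctionSpaces.Torus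
  Literature.Analysis.FluidPDE

namespace TopEig

open StrainL4 StrainMoment

/-! ## 4. Mean control through the radial map, and the regularised gradient bound for `a < 0` -/

section Torus

variable {d : Type*} [Fintype d] [DecidableEq d]
variable {F : Type*} [NormedAddCommGroup F] [InnerProductSpace ℝ F] [CompleteSpace F]

omit [DecidableEq d] in
/-- **Mean control through the radial map.** For a continuous `W : T^d → F` and `0 ≤ γ ≤ 1` with
`∫ ‖W‖^γ W = 0`: `‖∫W‖ ≤ 4 (∫‖W − ∫W‖²)^{1/2}` (`ψ(c) = ∫(ψ(c) − ψ(W))` for `ψ(w) = ‖w‖^γ w`,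
`c = ∫W`, the bound `norm_rpow_smul_sub_rpow_smul_le`, subadditivity of `t ↦ t^γ` and Jensen give
`‖c‖^{1+γ} ≤ 2‖c‖^γ√V + √V^{1+γ}`). This is the `a < 0` companion of
`CodomainNP.norm_integral_rpow_smul_le`. [ours; elementary] -/
theorem norm_integral_le_of_rpow_smul_mean_zero {W : UnitAddTorus d → F} (hW : Continuous W)
    {γ : ℝ} (hγ0 : 0 ≤ γ) (hγ1 : γ ≤ 1) (h0 : ∫ x, ‖W x‖ ^ γ • W x = 0) :
    ‖∫ x, W x‖ ≤ 4 * Real.sqrt (∫ x, ‖W x - ∫ y, W y‖ ^ 2) := by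
  set c : F := ∫ x, W x with hc
  set V : ℝ := ∫ x, ‖W x - c‖ ^ 2 with hV
  have hV0 : 0 ≤ V := integral_nonneg fun x => sq_nonneg _
  set r : ℝ := Real.sqrt V with hr
  have hr0 : 0 ≤ r := Real.sqrt_nonneg V
  rcases eq_or_ne c 0 with hc0 | hc0
  · rw [hc0, norm_zero]; positivity
  have hm : 0 < ‖c‖ := norm_pos_iff.2 hc0
  have hmγ : 0 < ‖c‖ ^ γ := Real.rpow_pos_of_pos hm _
  have hψW : Continuous fun x => ‖W x‖ ^ γ • W x :=
    (hW.norm.rpow_const fun _ => Or.inr hγ0).smul hW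
  have hdev : Continuous fun x => ‖W x - c‖ := (hW.sub continuous_const).norm
  -- `ψ(c) = ∫ (ψ(c) − ψ(W))`
  have hgc : ‖c‖ ^ γ • c = ∫ x, (‖c‖ ^ γ • c - ‖W x‖ ^ γ • W x) := by
    rw [integral_sub (integrable_const _) hψW.integrable_unitAddTorus, h0, sub_zero,
      integral_const, probReal_univ, one_smul]
  -- pointwise bound of the integrand
  have hpt : ∀ x, ‖‖c‖ ^ γ • c - ‖W x‖ ^ γ • W x‖ ≤
      2 * ‖c‖ ^ γ * ‖W x - c‖ + ‖W x - c‖ ^ (γ + 1) := by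
    intro x
    have h := norm_rpow_smul_sub_rpow_smul_le hγ0 hγ1 c (W x)
    rw [norm_sub_rev c (W x)] at h
    have hδ : 0 ≤ ‖W x - c‖ := norm_nonneg _
    have hWle : ‖W x‖ ^ γ ≤ ‖c‖ ^ γ + ‖W x - c‖ ^ γ := by
      have htri : ‖W x‖ ≤ ‖c‖ + ‖W x - c‖ := by
        have := norm_add_le c (W x - c); rwa [add_sub_cancel] at this
      calc ‖W x‖ ^ γ ≤ (‖c‖ + ‖W x - c‖) ^ γ := Real.rpow_le_rpow (norm_nonneg _) htri hγ0
        _ ≤ ‖c‖ ^ γ + ‖W x - c‖ ^ γ :=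
            Real.rpow_add_le_add_rpow (norm_nonneg _) hδ hγ0 hγ1
    have e1 : ‖W x - c‖ ^ (γ + 1) = ‖W x - c‖ ^ γ * ‖W x - c‖ := by
      rw [Real.rpow_add' hδ (by linarith), Real.rpow_one]
    calc ‖‖c‖ ^ γ • c - ‖W x‖ ^ γ • W x‖ ≤ (‖c‖ ^ γ + ‖W x‖ ^ γ) * ‖W x - c‖ := h
      _ ≤ (‖c‖ ^ γ + (‖c‖ ^ γ + ‖W x - c‖ ^ γ)) * ‖W x - c‖ := by gcongr
      _ = 2 * ‖c‖ ^ γ * ‖W x - c‖ + ‖W x - c‖ ^ (γ + 1) := by rw [e1]; ring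
  -- integrate
  have hI1 : Integrable (fun x => 2 * ‖c‖ ^ γ * ‖W x - c‖) volume :=
    (hdev.const_mul _).integrable_unitAddTorus
  have hI2 : Integrable (fun x => ‖W x - c‖ ^ (γ + 1)) volume :=
    (hdev.rpow_const fun _ => Or.inr (by linarith)).integrable_unitAddTorus
  have h1 : ‖c‖ ^ γ * ‖c‖ ≤ 2 * ‖c‖ ^ γ * (∫ x, ‖W x - c‖) + ∫ x, ‖W x - c‖ ^ (γ + 1) := by
    have e0 : ‖‖c‖ ^ γ • c‖ = ‖c‖ ^ γ * ‖c‖ := by rw [norm_smul, Real.norm_of_nonneg hmγ.le]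
    rw [← e0, hgc]
    calc ‖∫ x, (‖c‖ ^ γ • c - ‖W x‖ ^ γ • W x)‖
        ≤ ∫ x, ‖‖c‖ ^ γ • c - ‖W x‖ ^ γ • W x‖ := norm_integral_le_integral_norm _
      _ ≤ ∫ x, (2 * ‖c‖ ^ γ * ‖W x - c‖ + ‖W x - c‖ ^ (γ + 1)) :=
          integral_mono (continuous_const.sub hψW).norm.integrable_unitAddTorus (hI1.add hI2) hpt
      _ = 2 * ‖c‖ ^ γ * (∫ x, ‖W x - c‖) + ∫ x, ‖W x - c‖ ^ (γ + 1) := by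
          rw [integral_add hI1 hI2, integral_const_mul]
  have h2 : ∫ x, ‖W x - c‖ ≤ r := VelocityL4.integral_le_sqrt_integral_sq hdev
  have h3 : ∫ x, ‖W x - c‖ ^ (γ + 1) ≤ r ^ γ * r := by
    have hβ0 : 0 < (γ + 1) / 2 := by linarith
    have hβ1 : (γ + 1) / 2 ≤ 1 := by linarith
    have e2 : ∀ x, ‖W x - c‖ ^ (γ + 1) = (‖W x - c‖ ^ 2) ^ ((γ + 1) / 2) := fun x => by
      rw [← Real.rpow_natCast, ← Real.rpow_mul (norm_nonneg _)]
      congr 1; push_cast; ring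
    have hJ := NonlinearPoincare.integral_rpow_le_rpow_integral (hdev.pow 2)
      (fun x => sq_nonneg _) hβ0 hβ1
    have e3 : (∫ x, ‖W x - c‖ ^ 2) ^ ((γ + 1) / 2) = r ^ γ * r := by
      have hV' : V = r ^ 2 := (Real.sq_sqrt hV0).symm
      show V ^ ((γ + 1) / 2) = r ^ γ * r
      rw [hV', ← Real.rpow_natCast, ← Real.rpow_mul hr0,
        show ((2 : ℕ) : ℝ) * ((γ + 1) / 2) = γ + 1 by push_cast; ring,
        Real.rpow_add' hr0 (by linarith), Real.rpow_one]
    simp_rw [e2]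
    rw [← e3]
    exact hJ
  -- conclude `‖c‖ ≤ 4 r`
  by_cases hle : r ≤ ‖c‖
  · have hrγ : r ^ γ * r ≤ ‖c‖ ^ γ * r :=
      mul_le_mul_of_nonneg_right (Real.rpow_le_rpow hr0 hle hγ0) hr0
    by_contra hlt
    have hlt' : 4 * r < ‖c‖ := lt_of_not_ge hlt
    have h4 : ‖c‖ ^ γ * (4 * r) < ‖c‖ ^ γ * ‖c‖ := mul_lt_mul_of_pos_left hlt' hmγ
    nlinarith
  · linarith

omit [CompleteSpace F] in
/-- **Derivative bound for the regularisation at any real exponent**: for `ε > 0`,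
`‖∂ₖ((‖u‖² + ε)^{a/2} u)‖ ≤ (1 + |a|) (‖u‖² + ε)^{a/2} ‖∂ₖu‖` (the `a ≥ 0` case is
`CodomainNP.norm_partialDeriv_regA_le`). [ours] -/
theorem norm_partialDeriv_regA_le_abs {u : UnitAddTorus d → F} (hu : IsSmooth u)
    (a : ℝ) {ε : ℝ} (hε : 0 < ε) (k : d) (x : UnitAddTorus d) :
    ‖partialDeriv k (fun y => (‖u y‖ ^ 2 + ε) ^ (a / 2) • u y) x‖ ≤
      (1 + |a|) * (‖u x‖ ^ 2 + ε) ^ (a / 2) * ‖partialDeriv k u x‖ := by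
  have hθ : IsContDiff 1 (fun y => (‖u y‖ ^ 2 + ε) ^ (a / 2)) :=
    (CodomainNP.isSmooth_rpow_normSq_add hu hε (a / 2)).isContDiff (by simp)
  have hu1 : IsContDiff 1 u := hu.isContDiff (by simp)
  rw [partialDeriv_smul hθ hu1, CodomainNP.partialDeriv_rpow_normSq_add hu hε]
  obtain ⟨h, hh⟩ : ∃ h : ℝ, h = ‖u x‖ ^ 2 + ε := ⟨_, rfl⟩
  have hpos : 0 < h := by rw [hh]; positivity
  rw [← hh]
  have h1 : ‖h ^ (a / 2) • partialDeriv k u x‖ = h ^ (a / 2) * ‖partialDeriv k u x‖ := by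
    rw [norm_smul, Real.norm_of_nonneg (Real.rpow_nonneg hpos.le _)]
  have hkey : h ^ (a / 2 - 1) * ‖u x‖ ^ 2 ≤ h ^ (a / 2) := by
    have hu2 : ‖u x‖ ^ 2 ≤ h := by rw [hh]; linarith
    calc h ^ (a / 2 - 1) * ‖u x‖ ^ 2 ≤ h ^ (a / 2 - 1) * h :=
          mul_le_mul_of_nonneg_left hu2 (Real.rpow_nonneg hpos.le _)
      _ = h ^ (a / 2) := by
          calc h ^ (a / 2 - 1) * h = h ^ (a / 2 - 1) * h ^ (1 : ℝ) := by rw [Real.rpow_one]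
            _ = h ^ (a / 2) := by rw [← Real.rpow_add hpos, sub_add_cancel]
  have h2 : ‖(a / 2 * h ^ (a / 2 - 1) * (2 * ⟪u x, partialDeriv k u x⟫)) • u x‖ ≤
      |a| * h ^ (a / 2) * ‖partialDeriv k u x‖ := by
    rw [norm_smul, Real.norm_eq_abs]
    have hcs : |⟪u x, partialDeriv k u x⟫| ≤ ‖u x‖ * ‖partialDeriv k u x‖ :=
      abs_real_inner_le_norm _ _
    have hr0 : 0 ≤ h ^ (a / 2 - 1) := Real.rpow_nonneg hpos.le _
    calc |a / 2 * h ^ (a / 2 - 1) * (2 * ⟪u x, partialDeriv k u x⟫)| * ‖u x‖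
        = |a| * h ^ (a / 2 - 1) * |⟪u x, partialDeriv k u x⟫| * ‖u x‖ := by
          rw [abs_mul, abs_mul, abs_mul, abs_div, abs_of_nonneg hr0, abs_two]
          ring
      _ ≤ |a| * h ^ (a / 2 - 1) * (‖u x‖ * ‖partialDeriv k u x‖) * ‖u x‖ := by gcongr
      _ = |a| * (h ^ (a / 2 - 1) * ‖u x‖ ^ 2) * ‖partialDeriv k u x‖ := by ring
      _ ≤ |a| * h ^ (a / 2) * ‖partialDeriv k u x‖ := by gcongr
  calc ‖h ^ (a / 2) • partialDeriv k u x +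
        (a / 2 * h ^ (a / 2 - 1) * (2 * ⟪u x, partialDeriv k u x⟫)) • u x‖
      ≤ ‖h ^ (a / 2) • partialDeriv k u x‖ +
          ‖(a / 2 * h ^ (a / 2 - 1) * (2 * ⟪u x, partialDeriv k u x⟫)) • u x‖ := norm_add_le _ _
    _ ≤ h ^ (a / 2) * ‖partialDeriv k u x‖ + |a| * h ^ (a / 2) * ‖partialDeriv k u x‖ := by
        rw [h1]; gcongr
    _ = (1 + |a|) * h ^ (a / 2) * ‖partialDeriv k u x‖ := by ring

omit [CompleteSpace F] in
/-- `∫ ∑ₖ ‖∂ₖ((‖u‖² + ε)^{a/2} u)‖² ≤ (1 + |a|)² ∫ (‖u‖² + ε)^a ∑ₖ ‖∂ₖu‖²`, any real `a`, `ε > 0`.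
[ours] -/
theorem dirichlet_regA_le_abs {u : UnitAddTorus d → F} (hu : IsSmooth u) (a : ℝ) {ε : ℝ}
    (hε : 0 < ε) :
    ∫ x, ∑ k, ‖partialDeriv k (fun y => (‖u y‖ ^ 2 + ε) ^ (a / 2) • u y) x‖ ^ 2 ≤
      (1 + |a|) ^ 2 * ∫ x, (‖u x‖ ^ 2 + ε) ^ a * ∑ k, ‖partialDeriv k u x‖ ^ 2 := by
  have hW := CodomainNP.isSmooth_regA hu hε (a / 2)
  have hpos : ∀ x, 0 < ‖u x‖ ^ 2 + ε := fun x => by positivity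
  have hc1 : Continuous fun x =>
      ∑ k, ‖partialDeriv k (fun y => (‖u y‖ ^ 2 + ε) ^ (a / 2) • u y) x‖ ^ 2 :=
    continuous_finsetSum _ fun k _ => (hW.partialDeriv k).continuous.norm.pow 2
  have hc2 : Continuous fun x => (‖u x‖ ^ 2 + ε) ^ a * ∑ k, ‖partialDeriv k u x‖ ^ 2 :=
    (((hu.continuous.norm.pow 2).add continuous_const).rpow_const fun x =>
      Or.inl (hpos x).ne').mul
      (continuous_finsetSum _ fun k _ => (hu.partialDeriv k).continuous.norm.pow 2)
  rw [← integral_const_mul]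
  refine integral_mono hc1.integrable_unitAddTorus (hc2.integrable_unitAddTorus.const_mul _)
    fun x => ?_
  simp only
  rw [Finset.mul_sum, Finset.mul_sum]
  refine Finset.sum_le_sum fun k _ => ?_
  have h := norm_partialDeriv_regA_le_abs hu a hε k x
  have h0 : 0 ≤ ‖partialDeriv k (fun y => (‖u y‖ ^ 2 + ε) ^ (a / 2) • u y) x‖ := norm_nonneg _
  have hsq : ((‖u x‖ ^ 2 + ε) ^ (a / 2)) ^ 2 = (‖u x‖ ^ 2 + ε) ^ a := by
    rw [← Real.rpow_natCast, ← Real.rpow_mul (hpos x).le]; norm_num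
  calc ‖partialDeriv k (fun y => (‖u y‖ ^ 2 + ε) ^ (a / 2) • u y) x‖ ^ 2
      ≤ ((1 + |a|) * (‖u x‖ ^ 2 + ε) ^ (a / 2) * ‖partialDeriv k u x‖) ^ 2 :=
        pow_le_pow_left₀ h0 h 2
    _ = (1 + |a|) ^ 2 * ((‖u x‖ ^ 2 + ε) ^ a * ‖partialDeriv k u x‖ ^ 2) := by
        rw [← hsq]; ring

end Torus

/-! ## 5. The pairing `ψ` along a line and secant-below-tangent, every real `q > 1` -/

section Line

variable {v w : UnitAddTorus (Fin 3) → EuclideanSpace ℝ (Fin 3)}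

/-- `τ ↦ ψ(τ) = ∫ q (|S+τB|²)^{q/2−1}⟨S+τB, B⟩` is continuous for every real `q > 1` (the integrand is
`q ⟨(‖z‖²)^{q/2−1} z, B⟩` at `z = S + τB`, continuous in `z` since `q/2 − 1 > −1/2`); extends
`continuous_strainLinePairing` (`q > 2`). [ours] -/
theorem continuous_strainLinePairing_of_one_lt {q : ℝ} (hq : 1 < q) (hv : Torus.IsSmooth v)
    (hw : Torus.IsSmooth w) : Continuous (strainLinePairing q v w) := by
  unfold strainLinePairing
  have hb : -1 / 2 < q / 2 - 1 := by linarith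
  have hSc := continuous_strainFlat hv
  have hBc := continuous_strainFlat hw
  have hlin : Continuous fun p : ℝ × UnitAddTorus (Fin 3) =>
      strainFlat v p.2 + p.1 • strainFlat w p.2 :=
    (hSc.comp continuous_snd).add (continuous_fst.smul (hBc.comp continuous_snd))
  have hP : Continuous fun p : ℝ × UnitAddTorus (Fin 3) =>
      (‖strainFlat v p.2 + p.1 • strainFlat w p.2‖ ^ 2) ^ (q / 2 - 1) •
        (strainFlat v p.2 + p.1 • strainFlat w p.2) :=
    (continuous_rpow_normSq_smul hb).comp hlin
  have hF : Continuous (Function.uncurry fun (τ : ℝ) (x : UnitAddTorus (Fin 3)) =>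
      q * (‖strainFlat v x + τ • strainFlat w x‖ ^ 2) ^ (q / 2 - 1) *
        ⟪strainFlat v x + τ • strainFlat w x, strainFlat w x⟫_ℝ) := by
    refine ((hP.inner (hBc.comp continuous_snd)).const_mul q).congr fun p => ?_
    rcases p with ⟨τ, x⟩
    simp only [Function.uncurry_apply_pair, Function.comp_apply, real_inner_smul_left]
    ring
  have h := continuous_parametric_integral_of_continuous (μ := volume) hF isCompact_univ
  simpa only [Measure.restrict_univ] using h

/-- **Secant-below-tangent for `Z_q` along a line, every real `q > 1`**:
`Z_q(v + τw) − Z_q(v) ≤ τ ψ(τ)` (the integrated `norm_sq_rpow_sub_le_of_one_lt`); extends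
`strainMoment_line_sub_le` (`q > 2`). [ours] -/
theorem strainMoment_line_sub_le_of_one_lt {q : ℝ} (hq : 1 < q) (hv : Torus.IsSmooth v)
    (hw : Torus.IsSmooth w) (τ : ℝ) :
    torusStrainMoment q (v + τ • w) - torusStrainMoment q v ≤ τ * strainLinePairing q v w τ := by
  have hb : -1 / 2 < q / 2 - 1 := by linarith
  have hSc := continuous_strainFlat hv
  have hBc := continuous_strainFlat hw
  have hlin : ∀ t : ℝ, Continuous fun x => strainFlat v x + t • strainFlat w x := fun t =>
    hSc.add ((continuous_const (y := t)).smul hBc)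
  have hcq : ∀ t : ℝ, Continuous fun x => (‖strainFlat v x + t • strainFlat w x‖ ^ 2) ^ (q / 2) :=
    fun t => ((hlin t).norm.pow 2).rpow_const fun _ => Or.inr (by linarith)
  have hcI : Continuous fun x => q * (‖strainFlat v x + τ • strainFlat w x‖ ^ 2) ^ (q / 2 - 1) *
      ⟪strainFlat v x + τ • strainFlat w x, strainFlat w x⟫_ℝ := by
    refine ((((continuous_rpow_normSq_smul hb).comp (hlin τ)).inner hBc).const_mul q).congr
      fun x => ?_
    simp only [Function.comp_apply, real_inner_smul_left]
    ring
  have h0 : torusStrainMoment q v =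
      ∫ x, (‖strainFlat v x + (0 : ℝ) • strainFlat w x‖ ^ 2) ^ (q / 2) := by
    rw [← strainMoment_line_eq q hv hw 0, zero_smul, add_zero]
  rw [strainMoment_line_eq q hv hw τ, h0,
    ← integral_sub (hcq τ).integrable_unitAddTorus (hcq 0).integrable_unitAddTorus]
  unfold strainLinePairing
  rw [← integral_const_mul]
  refine integral_mono ((hcq τ).integrable_unitAddTorus.sub (hcq 0).integrable_unitAddTorus)
    (hcI.integrable_unitAddTorus.const_mul τ) fun x => ?_
  have h := norm_sq_rpow_sub_le_of_one_lt hq (strainFlat v x) (strainFlat w x) τ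
  simpa only [zero_smul, add_zero] using h

end Line

end TopEig

end Summit.NavierStokesRegularity.FunctionalMining
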